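/-
Copyright (c) 2026 the pub-hodgecm-mathlib formalisation cell (harness21).  Prover seat hodgecm-mathlib-K2E3-p03 (g7), HCML Track B «K2-LIT» ∕ h413
(`stmt-HodgeConjecture-24833`), leaf (nsc-S-A′), brick GEO-QB‴ (K2E3-p17 (g8)'s S4 census, route (T) «transport»), part 1: TRANSPORT OF JACQUET EXPONENT
MULTIPLICITIES ALONG AN AUTOMORPHISM PRESERVING `(P_c, U_c)`, and its `GL₃`∕Borel∕`θ = gkAutomorphism` instance.  2026-09-04.
-/
import Summits.HodgeConjecture.HodgeConjecture.Theorems.K2E3GL3WeakCellLemmaTransport      -- ★ E4b-T (K2E3-p25): `map_coinvariantsKer_eq`, `coinvariantsMk_apply_mul_unipotent`, borel lemmas for `gkAutomorphism`; brings ★ T1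
import Summits.HodgeConjecture.HodgeConjecture.Theorems.K2E3JacquetExponentMultiset           -- ★ E1a: `finrank_weightSpace_eq_of_linearEquiv`
import Literature.NumberTheory.Automorphic.SmoothIndTransport                              -- ★ `rootDeltaChar_transport`
import Literature.NumberTheory.Automorphic.ParabolicInductionProofs                         -- ★ `rootDeltaChar_eq_one_of_mem_unipotentRadicalP`
import Literature.NumberTheory.Automorphic.ParabolicSemidirect                              -- ★ `blockDiagonalGL_apply_coe_dite`
import HarnessLib

/-!
# K2_E3 road (h413), leaf (nsc-S-A′), brick GEO-QB‴ part 1 — transport of normalised Jacquet weights along an automorphism `θ` with `θ(P_c) = P_c`, `θ(U_c) ⊆ U_c`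

Cell `pub/hodgecm-mathlib` (D-0151), Track B, seat K2E3-p03 (g7) (FREE brick GEO-QB‴ of K2E3-p17 (g8)'s S4 census v0.2, taken 13:15Z; route (T) posted 13:20Z).
`--supports stmt-HodgeConjecture-24833 --as helper`; THEOREMS ONLY (no `def`, no instance, no notation, no named fact, no `sorry`); never imports `Cruxes/…/Lines`.  COUNT-NEUTRAL.

THE MATHEMATICS ([BernsteinZelevinsky1976, §2.21–2.25]; [BernsteinZelevinsky1977, §1.8–1.9, §2.3]; [Zelevinsky1980, §1.1]).  `θ` a continuous involutive automorphism of `GL_n(F)`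
with `θ(P_c) = P_c` and `θ(U_c) ⊆ U_c`; `π`, `π′` representations of `GL_n(F)` with a `θ`-equivariant linear isomorphism `Φ : V ≃ V′` (`Φ(π g v) = π′(θ g)(Φ v)`).  Then
`[v] ↦ [Φ v]` is a linear isomorphism `r_c π ≃ r_c π′` (★ E4b-T `map_coinvariantsKer_eq`) intertwining the NORMALISED Levi actions through the Levi automorphism
`θ_M(m) = proj_c(θ(diag m))` (an involution; `δ_{P_c}∘θ = δ_{P_c}` by ★ `rootDeltaChar_transport`, `U_c` invisible in `r_c`), whence for every weight function `ζ`: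
**`mult_{r_c π}(ζ) = mult_{r_c π′}(ζ ∘ θ_M)`** (`finrank_weightSpace_normalizedJacquetGL_eq_of_transport`, ★ E1a).  For `GL₃(F)`, the Borel and `θ = gkAutomorphism`
(`g ↦ w₀ ᵗg⁻¹ w₀`): `θ_T(t₀,t₁,t₂) = (t₂⁻¹,t₁⁻¹,t₀⁻¹)`, so `tch(a,b,c) ∘ θ_T = tch(c⁻¹,b⁻¹,a⁻¹)` (`tch_comp_leviAut_gkAutomorphism`) — the exponent table of a `P₁₂`-standard
module is thus the reversed-inverted table of a `P₂₁`-standard module (part 2, `K2E3GL3StandardModuleJacquetDimensionPrime`).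

HONEST LABEL: HC_CM is proved only modulo the 7 printed citations (2 remaining named inputs: hLiu418 = stmt-HodgeConjecture-24832, h413 = stmt-HodgeConjecture-24833) until rung 0
closes; count-neutral generic helper.

## Mathlib ∕ tree search
★ `map_coinvariantsKer_eq`, `coinvariantsMk_apply_mul_unipotent` (K2E3JacquetModuleAutomorphismTransport); ★ `leviProjection_apply_eq_of_ker`, `coe_gkAutomorphism_apply` (T1
`K2E3GL3OuterAutomorphismInduction`); ★ `gkAutomorphism_mem_borel_iff`, `gkAutomorphism_mem_unipotentRadical_borel`, `mem_unipotentRadicalP_iff` (K2E3GL3WeakCellLemmaTransport ∕ T1);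
★ `rootDeltaChar_transport`, ★ `rootDeltaChar_eq_one_of_mem_unipotentRadicalP`, ★ `finrank_weightSpace_eq_of_linearEquiv`, ★ `blockDiagonalGL_apply_coe_dite`, ★ `normalizedJacquetGL_mk`;
Mathlib `Submodule.Quotient.equiv`, `Function.Surjective.iInf_comp`, `Matrix.det_eq_elem_of_subsingleton`.  Dedup: `rg "JacquetWeightTransport|eq_of_transport|tch_comp_leviAut"` — none.

## References
* [BernsteinZelevinsky1976] I. N. Bernstein, A. V. Zelevinsky, *Representations of the group GL(n,F) where F is a non-archimedean local field*, Russian Math. Surveys 31 (1976), §2.21–2.25.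
* [BernsteinZelevinsky1977] I. N. Bernstein, A. V. Zelevinsky, *Induced representations of reductive p-adic groups I*, Ann. Sci. ÉNS 10 (1977), §1.8–1.9, §2.3.
* [Zelevinsky1980] A. V. Zelevinsky, *Induced representations of reductive p-adic groups II*, Ann. Sci. ÉNS 13 (1980), §1.1.
-/

set_option autoImplicit false
set_option linter.dupNamespace false

noncomputable section

open Function Representation Module Module.End
open scoped MatrixGroups
open Literature.NumberTheory.Automorphic
open Summit.HodgeConjecture.HodgeConjecture.Cruxes.H413.K2E3GL3OuterAutomorphismInduction
open Summit.HodgeConjecture.HodgeConjecture.Cruxes.H413.K2E3JacquetModuleAutomorphismTransport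
open Summit.HodgeConjecture.HodgeConjecture.Cruxes.H413.K2E3JacquetExponentMultiset

namespace Summit.HodgeConjecture.HodgeConjecture.Cruxes.H413.K2E3JacquetWeightTransport

/-! ## §1 Transport of normalised Jacquet weights along `θ` with `θ(P_c) = P_c`, `θ(U_c) ⊆ U_c` -/

universe v

section Generic

variable (F : Type*) [Field F] [ValuativeRel F] [TopologicalSpace F] [IsNonarchimedeanLocalField F]
  {n : Type*} [Fintype n] [DecidableEq n] {α : Type*} [LinearOrder α] [Fintype α] (c : n → α)

omit [ValuativeRel F] [TopologicalSpace F] [IsNonarchimedeanLocalField F] in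
/-- The Levi automorphism `θ_M(m) = proj_c(θ(diag m))` is an involution when `θ` is (`θ(diag m) ∈ diag(θ_M m)·U_c` and `θ(U_c) ⊆ U_c`, ★ `leviProjection_apply_eq_of_ker`).
[cite: BernsteinZelevinsky1977, §2.1, §2.3] -/
theorem leviAut_leviAut (θ : GL n F ≃* GL n F) (hθθ : ∀ g, θ (θ g) = g)
    (hP : ∀ x, θ x ∈ standardParabolicGL F c ↔ x ∈ standardParabolicGL F c)
    (hU : ∀ p : ↥(standardParabolicGL F c), p ∈ unipotentRadicalP F c →
      (⟨θ p, (hP p).2 p.2⟩ : ↥(standardParabolicGL F c)) ∈ unipotentRadicalP F c)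
    (m : Π a, GL {i // c i = a} F) :
    leviProjection F c ⟨θ (blockDiagonalGL F c (leviProjection F c ⟨θ (blockDiagonalGL F c m), (hP _).2 (blockDiagonalGL_mem c m)⟩)),
        (hP _).2 (blockDiagonalGL_mem c _)⟩ = m := by
  have h1 := leviProjection_apply_eq_of_ker F c c θ hP hU ⟨θ (blockDiagonalGL F c m), (hP _).2 (blockDiagonalGL_mem c m)⟩
  have h2 : (⟨θ ((⟨θ (blockDiagonalGL F c m), (hP _).2 (blockDiagonalGL_mem c m)⟩ : ↥(standardParabolicGL F c)) : GL n F), (hP _).2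
      (⟨θ (blockDiagonalGL F c m), (hP _).2 (blockDiagonalGL_mem c m)⟩ : ↥(standardParabolicGL F c)).2⟩ : ↥(standardParabolicGL F c)) = leviEmbeddingP F c m :=
    Subtype.ext (hθθ _)
  rw [h2, leviProjection_leviEmbeddingP_apply] at h1
  exact h1.symm

/-- **TRANSPORT OF NORMALISED JACQUET WEIGHTS ALONG `θ`.**  `θ` a continuous involutive automorphism of `GL_n(F)` with `θ(P_c) = P_c`, `θ(U_c) ⊆ U_c`; `Φ : V ≃ V′` linear with
`Φ(π g v) = π′(θ g)(Φ v)`.  Then for every weight function `ζ` on the Levi: `mult_{r_c π}(ζ) = mult_{r_c π′}(ζ ∘ θ_M)`, `θ_M(m) = proj_c(θ(diag m))` — the isomorphism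
`[v] ↦ [Φ v]` of Jacquet modules (★ E4b-T) intertwines `r(m)` with `r′(θ_M m)` for the NORMALISED actions (`δ^{1∕2}(diag m) = δ^{1∕2}(diag(θ_M m))`, ★ `rootDeltaChar_transport`).
[cite: BernsteinZelevinsky1976, §2.23] [cite: BernsteinZelevinsky1977, Prop. 1.9, §2.3] [cite: Zelevinsky1980, §1.1] -/
theorem finrank_weightSpace_normalizedJacquetGL_eq_of_transport [LocallyCompactSpace ↥(standardParabolicGL F c)]
    (θ : GL n F ≃ₜ* GL n F) (hθθ : ∀ g, θ (θ g) = g)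
    (hP : ∀ x, θ x ∈ standardParabolicGL F c ↔ x ∈ standardParabolicGL F c)
    (hU : ∀ p : ↥(standardParabolicGL F c), p ∈ unipotentRadicalP F c →
      (⟨θ p, (hP p).2 p.2⟩ : ↥(standardParabolicGL F c)) ∈ unipotentRadicalP F c)
    {V V' : Type v} [AddCommGroup V] [Module ℂ V] [AddCommGroup V'] [Module ℂ V']
    (π : Representation ℂ (GL n F) V) (π' : Representation ℂ (GL n F) V') (Φ : V ≃ₗ[ℂ] V')
    (hΦ : ∀ (g : GL n F) (v : V), Φ (π g v) = π' (θ g) (Φ v)) (ζ : (Π a, GL {i // c i = a} F) → ℂ) :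
    finrank ℂ ↥(⨅ m, Module.End.maxGenEigenspace (normalizedJacquetGL F c π m) (ζ m)) =
      finrank ℂ ↥(⨅ m, Module.End.maxGenEigenspace (normalizedJacquetGL F c π' m)
        (ζ (leviProjection F c ⟨θ (blockDiagonalGL F c m), (hP _).2 (blockDiagonalGL_mem c m)⟩))) := by
  -- `θ` on `P_c` and the Levi automorphism `gθ`
  let θP : ↥(standardParabolicGL F c) →* ↥(standardParabolicGL F c) :=
    ((θ : GL n F ≃* GL n F).toMonoidHom.comp (standardParabolicGL F c).subtype).codRestrict _ fun p => (hP p).2 p.2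
  let gθ : (Π a, GL {i // c i = a} F) →* (Π a, GL {i // c i = a} F) := ((leviProjection F c).comp θP).comp (leviEmbeddingP F c)
  have hgθ : ∀ m, gθ m = leviProjection F c ⟨θ (blockDiagonalGL F c m), (hP _).2 (blockDiagonalGL_mem c m)⟩ := fun m => rfl
  have hinv : ∀ m, gθ (gθ m) = m := fun m => by
    rw [hgθ, hgθ]
    exact leviAut_leviAut F c (θ : GL n F ≃* GL n F) hθθ hP hU m
  have hsurj : Function.Surjective gθ := fun m => ⟨gθ m, hinv m⟩
  -- the linear isomorphism of coinvariants `L [v] = [Φ v]`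
  have hker := map_coinvariantsKer_eq F c c (θ : GL n F ≃* GL n F) hθθ hP hP hU hU π π' Φ hΦ
  let L : (restrictUnipotentGL F c π).Coinvariants ≃ₗ[ℂ] (restrictUnipotentGL F c π').Coinvariants :=
    Submodule.Quotient.equiv (Coinvariants.ker (restrictUnipotentGL F c π)) (Coinvariants.ker (restrictUnipotentGL F c π')) Φ hker
  have hL : ∀ v : V, L (Coinvariants.mk (restrictUnipotentGL F c π) v) = Coinvariants.mk (restrictUnipotentGL F c π') (Φ v) := fun v => rfl
  -- `L` intertwines the NORMALISED actions through `gθ`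
  have hLm : ∀ (m : Π a, GL {i // c i = a} F) (x : (restrictUnipotentGL F c π).Coinvariants),
      L (normalizedJacquetGL F c π m x) = normalizedJacquetGL F c π' (gθ m) (L x) := by
    intro m x
    induction x using Representation.Coinvariants.induction_on with
    | h v =>
      rw [normalizedJacquetGL_mk, map_smul, hL, hL, normalizedJacquetGL_mk, hΦ]
      -- `θ (diag m) = diag (gθ m) · u'` with `u' ∈ U_c`
      have hu : (leviEmbeddingP F c (gθ m))⁻¹ * θP (leviEmbeddingP F c m) ∈ unipotentRadicalP F c := by
        rw [MonoidHom.mem_ker, map_mul, map_inv, leviProjection_leviEmbeddingP_apply]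
        exact inv_mul_cancel _
      have hdec : (θ : GL n F ≃* GL n F) (blockDiagonalGL F c m) =
          ((leviEmbeddingP F c (gθ m) : ↥(standardParabolicGL F c)) : GL n F) *
            (((leviEmbeddingP F c (gθ m))⁻¹ * θP (leviEmbeddingP F c m) : ↥(standardParabolicGL F c)) : GL n F) := by
        rw [Subgroup.coe_mul, Subgroup.coe_inv, mul_inv_cancel_left]
        rfl
      have h1 : Coinvariants.mk (restrictUnipotentGL F c π') (π' (θ (blockDiagonalGL F c m)) (Φ v)) =
          Coinvariants.mk (restrictUnipotentGL F c π') (π' (blockDiagonalGL F c (gθ m)) (Φ v)) := by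
        have e : π' (θ (blockDiagonalGL F c m)) (Φ v) =
            π' (((leviEmbeddingP F c (gθ m) : ↥(standardParabolicGL F c)) : GL n F) *
              (((leviEmbeddingP F c (gθ m))⁻¹ * θP (leviEmbeddingP F c m) : ↥(standardParabolicGL F c)) : GL n F)) (Φ v) := by
          rw [← hdec]; rfl
        rw [e, coinvariantsMk_apply_mul_unipotent F c π' _ hu]
        rfl
      -- `δ(diag m) = δ(θ (diag m)) = δ(diag (gθ m) · u') = δ(diag (gθ m))`
      have h2 : rootDeltaChar (standardParabolicGL F c) (leviEmbeddingP F c m) = rootDeltaChar (standardParabolicGL F c) (leviEmbeddingP F c (gθ m)) := by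
        rw [rootDeltaChar_transport (θ : GL n F ≃* GL n F) θ.continuous θ.symm.continuous hP (leviEmbeddingP F c m)]
        have e : (⟨(θ : GL n F ≃* GL n F) ((leviEmbeddingP F c m : ↥(standardParabolicGL F c)) : GL n F), (hP _).2 (leviEmbeddingP F c m).2⟩ :
            ↥(standardParabolicGL F c)) = leviEmbeddingP F c (gθ m) * ((leviEmbeddingP F c (gθ m))⁻¹ * θP (leviEmbeddingP F c m)) := by
          rw [mul_inv_cancel_left]; rfl
        rw [e, map_mul, rootDeltaChar_eq_one_of_mem_unipotentRadicalP (F := F) (c := c) hu, mul_one]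
      rw [h1, h2]
  -- weights along `L`
  have hw := finrank_weightSpace_eq_of_linearEquiv (normalizedJacquetGL F c π) ((normalizedJacquetGL F c π').comp gθ) L (fun m x => hLm m x) ζ
  rw [hw]
  -- reindex the infimum along the involution `gθ`
  have hre : (⨅ m, Module.End.maxGenEigenspace (((normalizedJacquetGL F c π').comp gθ) m) (ζ m)) =
      ⨅ m, Module.End.maxGenEigenspace (normalizedJacquetGL F c π' m) (ζ (gθ m)) := by
    rw [← hsurj.iInf_comp (fun m' => Module.End.maxGenEigenspace (normalizedJacquetGL F c π' m') (ζ (gθ m')))]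
    refine iInf_congr fun m => ?_
    rw [hinv]
    rfl
  rw [hre]
  rfl

end Generic

/-! ## §2 `GL₃(F)`, the Borel and `θ = gkAutomorphism`: `θ_T(t₀,t₁,t₂) = (t₂⁻¹,t₁⁻¹,t₀⁻¹)` and `tch(a,b,c) ∘ θ_T = tch(c⁻¹,b⁻¹,a⁻¹)` -/

section GL3

variable {F : Type} [Field F] [ValuativeRel F] [TopologicalSpace F] [IsNonarchimedeanLocalField F]

/-- Each block `{i // id i = a}` of the Borel labelling of `GL₃` is a singleton. [folklore] -/
theorem subsingleton_block_id (a : Fin 3) : Subsingleton {i : Fin 3 // (id : Fin 3 → Fin 3) i = a} :=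
  ⟨fun i j => Subtype.ext (i.2.trans j.2.symm)⟩

/-- `θ(U_B) ⊆ U_B` in the `unipotentRadicalP` spelling (★ `gkAutomorphism_mem_unipotentRadical_borel` + ★ `mem_unipotentRadicalP_iff`). [cite: Zelevinsky1980, §1.1] -/
theorem gkAutomorphism_mem_unipotentRadicalP_borel (p : ↥(standardParabolicGL F (id : Fin 3 → Fin 3))) (hp : p ∈ unipotentRadicalP F (id : Fin 3 → Fin 3)) :
    (⟨gkAutomorphism (p : GL (Fin 3) F), (K2E3GL3WeakCellLemmaTransport.gkAutomorphism_mem_borel_iff F _).2 p.2⟩ :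
      ↥(standardParabolicGL F (id : Fin 3 → Fin 3))) ∈ unipotentRadicalP F (id : Fin 3 → Fin 3) :=
  (mem_unipotentRadicalP_iff F _ _).2 (K2E3GL3WeakCellLemmaTransport.gkAutomorphism_mem_unipotentRadical_borel F ((mem_unipotentRadicalP_iff F _ _).1 hp))

/-- **`θ_T(t)_a = (t_{rev a})⁻¹`** at the level of block determinants: `det((θ_T t)_a) = det(t_{rev a})⁻¹` (entries of `θ(g) = w₀ ᵗg⁻¹ w₀` on the diagonal of
`diag t`). [cite: Zelevinsky1980, §1.1] [cite: Bump1997, §4.4] -/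
theorem det_leviAut_gkAutomorphism_apply (m : Π a : Fin 3, GL {i : Fin 3 // (id : Fin 3 → Fin 3) i = a} F) (a : Fin 3) :
    Matrix.GeneralLinearGroup.det (leviProjection F (id : Fin 3 → Fin 3) ⟨gkAutomorphism (blockDiagonalGL F (id : Fin 3 → Fin 3) m),
        (K2E3GL3WeakCellLemmaTransport.gkAutomorphism_mem_borel_iff F _).2 (blockDiagonalGL_mem (id : Fin 3 → Fin 3) m)⟩ a) =
      (Matrix.GeneralLinearGroup.det (m a.rev))⁻¹ := by
  haveI := subsingleton_block_id a
  haveI := subsingleton_block_id a.rev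
  rw [← map_inv, ← Pi.inv_apply]
  refine Units.ext ?_
  rw [Matrix.GeneralLinearGroup.val_det_apply, Matrix.GeneralLinearGroup.val_det_apply,
    Matrix.det_eq_elem_of_subsingleton _ (⟨a, rfl⟩ : {i : Fin 3 // (id : Fin 3 → Fin 3) i = a}),
    Matrix.det_eq_elem_of_subsingleton _ (⟨a.rev, rfl⟩ : {i : Fin 3 // (id : Fin 3 → Fin 3) i = a.rev}), leviProjection_apply_coe, Subgroup.coe_mk,
    coe_gkAutomorphism_apply, ← map_inv, blockDiagonalGL_apply_coe_dite, dif_pos rfl]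
  rfl

/-- **`tch(θv) ∘ θ_T = tch(θv₂⁻¹, θv₁⁻¹, θv₀⁻¹)`** as functions on the torus (`tch θ t = ∏ₐ θₐ(det tₐ)`, the currency of ★ H0-a ∕ ★ GEO-QB).
[cite: Zelevinsky1980, §1.1] [cite: BernsteinZelevinsky1977, §2.3] -/
theorem tch_comp_leviAut_gkAutomorphism (θv : Fin 3 → (Fˣ →* ℂˣ)) :
    (fun m : (Π a : Fin 3, GL {i : Fin 3 // (id : Fin 3 → Fin 3) i = a} F) =>
      ((((∏ a : Fin 3, ((θv a).comp (Matrix.GeneralLinearGroup.det.comp (Pi.evalMonoidHom (fun a : Fin 3 => GL {i : Fin 3 // (id : Fin 3 → Fin 3) i = a} F) a))))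
        (leviProjection F (id : Fin 3 → Fin 3) ⟨gkAutomorphism (blockDiagonalGL F (id : Fin 3 → Fin 3) m),
          (K2E3GL3WeakCellLemmaTransport.gkAutomorphism_mem_borel_iff F _).2 (blockDiagonalGL_mem (id : Fin 3 → Fin 3) m)⟩) : ℂˣ) : ℂ))) =
      fun m => (((∏ a : Fin 3, ((![(θv 2)⁻¹, (θv 1)⁻¹, (θv 0)⁻¹] : Fin 3 → (Fˣ →* ℂˣ)) a).comp
        (Matrix.GeneralLinearGroup.det.comp (Pi.evalMonoidHom (fun a : Fin 3 => GL {i : Fin 3 // (id : Fin 3 → Fin 3) i = a} F) a))) m : ℂˣ) : ℂ) := by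
  funext m
  congr 1
  rw [MonoidHom.finsetProd_apply, MonoidHom.finsetProd_apply, Fin.prod_univ_three, Fin.prod_univ_three]
  simp only [MonoidHom.coe_comp, Function.comp_apply, Pi.evalMonoidHom_apply, det_leviAut_gkAutomorphism_apply, map_inv, MonoidHom.inv_apply,
    Matrix.cons_val_zero, Matrix.cons_val_one, Matrix.head_cons, Matrix.cons_val_two, Matrix.tail_cons]
  rw [mul_comm, mul_comm ((θv 0) _)⁻¹, mul_assoc]
  rfl

/-- **TRANSPORT OF BOREL JACQUET WEIGHTS OF `GL₃(F)` ALONG `θ = gkAutomorphism`**: for `Φ : V ≃ V′` with `Φ(π g v) = π′(θ g)(Φ v)` and every weight function `ζ`,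
`mult_{r_B π}(ζ) = mult_{r_B π′}(ζ ∘ θ_T)` (§1 at `n = 3`, `c = id`, `θ(B) = B`, `θ(U) ⊆ U` ★ E4b-T). [cite: BernsteinZelevinsky1976, §2.23] [cite: Zelevinsky1980, §1.1] -/
theorem finrank_weightSpace_eq_of_gkAutomorphism {V V' : Type v} [AddCommGroup V] [Module ℂ V] [AddCommGroup V'] [Module ℂ V']
    (π : Representation ℂ (GL (Fin 3) F) V) (π' : Representation ℂ (GL (Fin 3) F) V') (Φ : V ≃ₗ[ℂ] V')
    (hΦ : ∀ (g : GL (Fin 3) F) (v : V), Φ (π g v) = π' (gkAutomorphism g) (Φ v)) (ζ : (Π a : Fin 3, GL {i : Fin 3 // (id : Fin 3 → Fin 3) i = a} F) → ℂ) :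
    finrank ℂ ↥(⨅ m, Module.End.maxGenEigenspace (normalizedJacquetGL F (id : Fin 3 → Fin 3) π m) (ζ m)) =
      finrank ℂ ↥(⨅ m, Module.End.maxGenEigenspace (normalizedJacquetGL F (id : Fin 3 → Fin 3) π' m)
        (ζ (leviProjection F (id : Fin 3 → Fin 3) ⟨gkAutomorphism (blockDiagonalGL F (id : Fin 3 → Fin 3) m),
          (K2E3GL3WeakCellLemmaTransport.gkAutomorphism_mem_borel_iff F _).2 (blockDiagonalGL_mem (id : Fin 3 → Fin 3) m)⟩))) :=
  finrank_weightSpace_normalizedJacquetGL_eq_of_transport F (id : Fin 3 → Fin 3) gkAutomorphism (K2E3GL3OuterAutomorphismInduction.gkAutomorphism_gkAutomorphism F)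
    (K2E3GL3WeakCellLemmaTransport.gkAutomorphism_mem_borel_iff F) (gkAutomorphism_mem_unipotentRadicalP_borel) π π' Φ hΦ ζ

end GL3

end Summit.HodgeConjecture.HodgeConjecture.Cruxes.H413.K2E3JacquetWeightTransport

end
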